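import Mathlib
import Summits.Ventures.PercRepro2.HCov
import Summits.Ventures.PercRepro2.GcInterior
import Summits.Ventures.PercRepro2.GcRational
import Summits.Ventures.PercRepro2.GcSkelRules
import Summits.Ventures.PercRepro2.GcSumEmbed
import Summits.Ventures.PercRepro2.GcDyadicExpand

/-!
# The uniform-½ reduction: the crux is (HCOV) at `p ≡ ½` on multigraphs (blind cell PercRepro2,
typer-1 g58)

`HCov_all ℝ ↔ HCov_all ℚ` (g55) put the crux at rational weights; the series and parallel
expansions (`GcDyadicExpand.lean`) put it at ONE weight. A dyadic weight `m / 2^k ∈ (0, 1)` is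
`(b + q) / 2` with `b ∈ {0, 1}`, `q = m' / 2^(k−1)`: a ½-edge in series (`b = 0`) or in parallel
(`b = 1`) with a `q`-edge, an exact identity of `Gc` on `V ⊕ Unit`, `E ⊕ Unit`. The measure
`∑_e (k_e − 1)` drops by one at each expansion (an even numerator halves, a loop takes the weight
½ outright), so every instance at dyadic interior weights has the `Gc` of a multigraph at the
uniform weight ½ (**`HCov_of_half_dyadic`**); the dyadic points of the open cube are dense in the
closed cube and `{p | 0 ≤ Gc p}` is closed (**`dense_dyadic`**, `isClosed_HCov`). Hence

* **`HCov_half_all R`** — (HCOV) at `p ≡ ½` on every finite multigraph with five distinct marks;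
* **`HCov_all_real_iff_half`**: `HCov_all ℝ ↔ HCov_half_all ℝ`, **`HCov_all_real_iff_half_rat`**:
  `HCov_all ℝ ↔ HCov_half_all ℚ` — THE CRUX IS A COUNTING STATEMENT: at `p ≡ ½` every
  configuration has the weight `2^{−|E|}` (**`weight_half`**, **`prob_half`**: `P(A) = |A| / 2^|E|`),
  so `2^{3|E|} · Gc` is an integer cubic form in the numbers of configurations of the pattern
  events, on every finite multigraph.

Standard axioms.
-/

namespace Summit.Ventures.PercRepro2

open CovForm

namespace Half

/-! ## The statement at `p ≡ ½` -/

section Defs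

variable (R : Type*) [Field R] [LinearOrder R] [IsStrictOrderedRing R]

/-- **(HCOV) at the uniform weight ½** on every finite multigraph with five distinct marks. -/
def HCov_half_all : Prop :=
  ∀ (V E : Type) [Fintype V] [DecidableEq V] [Fintype E] [DecidableEq E] (ends : E → Sym2 V),
    ∀ o a₁ a₂ a₃ b : V, a₁ ≠ a₂ → a₁ ≠ a₃ → a₂ ≠ a₃ → o ≠ a₁ → o ≠ a₂ → o ≠ a₃ → o ≠ b →
      b ≠ a₁ → b ≠ a₂ → b ≠ a₃ → HCov (fun _ => (1 / 2 : R)) ends o a₁ a₂ a₃ b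

end Defs

/-! ## The weights at ½ are counts -/

section Count

variable {E : Type*} [Fintype E] [DecidableEq E] {R : Type*} [Field R] [CharZero R]

omit [DecidableEq E] in
/-- At `p ≡ ½` every configuration has the weight `(1/2)^|E|`. -/
lemma weight_half (ω : Config E) :
    weight (fun _ : E => (1 / 2 : R)) ω = (1 / 2 : R) ^ Fintype.card E := by
  unfold weight
  have h : ∀ e, edgeFactor (1 / 2 : R) (ω e) = 1 / 2 := fun e => by
    cases ω e <;> norm_num [edgeFactor]
  simp only [h, Finset.prod_const, Finset.card_univ]

/-- **At `p ≡ ½` the probability of an event is a count**: `P(A) = |A| / 2^|E|`. -/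
theorem prob_half (A : Set (Config E)) [DecidablePred (· ∈ A)] :
    prob (fun _ : E => (1 / 2 : R)) A =
      ((Finset.univ.filter (· ∈ A)).card : R) / 2 ^ Fintype.card E := by
  rw [prob_eq_sum_filter]
  simp only [weight_half, Finset.sum_const, nsmul_eq_mul]
  rw [one_div, inv_pow, div_eq_mul_inv]

end Count

/-! ## Dyadic representations -/

section Dyadic

variable {E : Type*} {R : Type*} [Field R]

/-- `p` is the dyadic vector with numerators `m` and exponents `k`: `p e = m e / 2^(k e)` with
`0 < m e < 2^(k e)`. -/
def IsDyadicRep (p : E → R) (k m : E → ℕ) : Prop :=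
  ∀ e, 0 < m e ∧ m e < 2 ^ k e ∧ p e = (m e : R) / 2 ^ k e

/-- With every exponent at most one, the vector is the uniform ½. -/
lemma eq_half_of_rep {p : E → R} {k m : E → ℕ} (h : IsDyadicRep p k m) (hk : ∀ e, k e ≤ 1) :
    p = fun _ => (1 / 2 : R) := by
  funext e
  obtain ⟨hm0, hm1, hp⟩ := h e
  have hk1 : k e = 1 := by
    rcases Nat.lt_or_ge (k e) 1 with h1 | h1
    · have h0 : k e = 0 := by omega
      rw [h0, pow_zero] at hm1
      omega
    · exact le_antisymm (hk e) h1
  rw [hk1, pow_one] at hm1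
  have hm : m e = 1 := by omega
  rw [hp, hk1, hm]
  simp

end Dyadic

section Measure

variable {E : Type*} [Fintype E] [DecidableEq E]

/-- The measure `∑_e (k e − 1)`, with the exponent at `e` replaced. -/
lemma sum_update_sub_one (k : E → ℕ) (e : E) (K : ℕ) :
    ∑ e', (Function.update k e K e' - 1) = (K - 1) + ∑ e' ∈ Finset.univ.erase e, (k e' - 1) := by
  rw [← Finset.add_sum_erase _ _ (Finset.mem_univ e), Function.update_self]
  congr 1
  refine Finset.sum_congr rfl fun e' he' => ?_
  rw [Function.update_of_ne (Finset.ne_of_mem_erase he')]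

omit [DecidableEq E] in
/-- The measure `∑_e (k e − 1)` on `E ⊕ Unit` with the exponent `1` on the spare edge. -/
lemma sum_elim_sub_one (k : E → ℕ) :
    ∑ e', (Sum.elim k (fun _ : Unit => 1) e' - 1) = ∑ e', (k e' - 1) := by
  rw [Fintype.sum_sum_type]
  simp

end Measure

/-! ## The dyadic expansion -/

section Expansion

variable {R : Type*} [Field R] [LinearOrder R] [IsStrictOrderedRing R]

/-- **The dyadic expansion**: (HCOV) at `p ≡ ½` on every finite multigraph gives (HCOV) at every
dyadic interior weight vector — induction on the measure `∑_e (k_e − 1)`: an even numerator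
halves, a loop takes the weight ½, an odd numerator `m < 2^(k−1)` is a ½-edge in series with the
edge at `m / 2^(k−1)`, an odd numerator `m > 2^(k−1)` is a ½-edge in parallel with the edge at
`(m − 2^(k−1)) / 2^(k−1)`. -/
theorem HCov_of_half_dyadic (h : HCov_half_all R) (N : ℕ) :
    ∀ (V E : Type) [Fintype V] [DecidableEq V] [Fintype E] [DecidableEq E] (ends : E → Sym2 V)
      (p : E → R) (k m : E → ℕ), IsDyadicRep p k m → ∑ e, (k e - 1) ≤ N →
      ∀ o a₁ a₂ a₃ b : V, a₁ ≠ a₂ → a₁ ≠ a₃ → a₂ ≠ a₃ → o ≠ a₁ → o ≠ a₂ → o ≠ a₃ → o ≠ b →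
        b ≠ a₁ → b ≠ a₂ → b ≠ a₃ → HCov p ends o a₁ a₂ a₃ b := by
  induction N with
  | zero =>
    intro V E _ _ _ _ ends p k m hrep hsum o a₁ a₂ a₃ b h12 h13 h23 ho1 ho2 ho3 hob hb1 hb2 hb3
    have hk : ∀ e, k e ≤ 1 := by
      intro e
      have h0 : k e - 1 = 0 :=
        (Finset.sum_eq_zero_iff.1 (Nat.le_zero.1 hsum)) e (Finset.mem_univ e)
      omega
    rw [eq_half_of_rep hrep hk]
    exact h V E ends o a₁ a₂ a₃ b h12 h13 h23 ho1 ho2 ho3 hob hb1 hb2 hb3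
  | succ N ih =>
    intro V E _ _ _ _ ends p k m hrep hsum o a₁ a₂ a₃ b h12 h13 h23 ho1 ho2 ho3 hob hb1 hb2 hb3
    by_cases hall : ∀ e, k e ≤ 1
    · rw [eq_half_of_rep hrep hall]
      exact h V E ends o a₁ a₂ a₃ b h12 h13 h23 ho1 ho2 ho3 hob hb1 hb2 hb3
    push Not at hall
    obtain ⟨e, hke⟩ := hall
    obtain ⟨K', hK⟩ : ∃ K', k e = K' + 2 := ⟨k e - 2, by omega⟩
    obtain ⟨hm0, hm1, hpe⟩ := hrep e
    rw [hK] at hm1 hpe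
    -- the measure with the exponent at `e` lowered by one
    have hsum' : (K' + 1 - 1) + ∑ e' ∈ Finset.univ.erase e, (k e' - 1) ≤ N := by
      have hsplit : ∑ e', (k e' - 1) = (k e - 1) + ∑ e' ∈ Finset.univ.erase e, (k e' - 1) :=
        (Finset.add_sum_erase _ _ (Finset.mem_univ e)).symm
      rw [hsplit, hK] at hsum
      omega
    have h2pow : (2 : ℕ) ^ (K' + 2) = 2 ^ (K' + 1) * 2 := pow_succ 2 (K' + 1)
    -- the representation of the other edges is unchanged by an update at `e`
    have hrep_other : ∀ (q : R) (K M : ℕ), 0 < M → M < 2 ^ K → q = (M : R) / 2 ^ K →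
        IsDyadicRep (Function.update p e q) (Function.update k e K) (Function.update m e M) := by
      intro q K M hM0 hM1 hq e'
      by_cases he' : e' = e
      · subst he'
        simp only [Function.update_self]
        exact ⟨hM0, hM1, hq⟩
      · simp only [Function.update_of_ne he']
        exact hrep e'
    rcases Nat.even_or_odd (m e) with ⟨M', hM'⟩ | ⟨M', hM'⟩
    · -- an even numerator halves: the same instance, the exponent lowered
      have hq : p e = (M' : R) / 2 ^ (K' + 1) := by
        rw [hpe, hM']
        push_cast
        field_simp
        ring
      have hrep' := hrep_other (p e) (K' + 1) M' (by omega) (by rw [h2pow] at hm1; omega) hq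
      rw [Function.update_eq_self] at hrep'
      have hsum'' : ∑ e', (Function.update k e (K' + 1) e' - 1) ≤ N := by
        rw [sum_update_sub_one]
        exact hsum'
      exact ih V E ends p _ _ hrep' hsum'' o a₁ a₂ a₃ b h12 h13 h23 ho1 ho2 ho3 hob hb1 hb2 hb3
    by_cases hloop : (ends e).IsDiag
    · -- a loop takes the weight ½ outright
      have hrep' := hrep_other (1 / 2) 1 1 Nat.one_pos (by norm_num) (by norm_num)
      have hsum'' : ∑ e', (Function.update k e 1 e' - 1) ≤ N := by
        rw [sum_update_sub_one]
        omega
      have key := ih V E ends _ _ _ hrep' hsum'' o a₁ a₂ a₃ b h12 h13 h23 ho1 ho2 ho3 hob hb1 hb2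
        hb3
      unfold HCov at key ⊢
      rw [Expand.Gc_update_of_isDiag p hloop (1 / 2) o a₁ a₂ a₃ b]
      exact key
    -- an odd numerator at a non-loop edge: series (`m < 2^(k−1)`) or parallel (`m > 2^(k−1)`)
    obtain ⟨⟨x, w⟩, hxw'⟩ := Quot.exists_rep (ends e)
    have hf : ends e = s(x, w) := hxw'.symm
    have hxw : x ≠ w := by
      intro hxw
      apply hloop
      rw [hf, hxw, Sym2.mk_isDiag_iff]
    have hne : m e ≠ 2 ^ (K' + 1) := by
      rw [hM', pow_succ]
      omega
    have hsum'' : ∑ e', (Sum.elim (Function.update k e (K' + 1)) (fun _ : Unit => 1) e' - 1) ≤ N := by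
      rw [sum_elim_sub_one, sum_update_sub_one]
      exact hsum'
    rcases Nat.lt_or_gt_of_ne hne with hlt | hgt
    · -- series: `p e = ½ · (m e / 2^(k e − 1))`
      have hst : p e = (1 / 2 : R) * ((m e : R) / 2 ^ (K' + 1)) := by
        rw [hpe]
        field_simp
        ring
      have hrep' : IsDyadicRep
          (Sum.elim (Function.update p e ((m e : R) / 2 ^ (K' + 1))) fun _ : Unit => (1 / 2 : R))
          (Sum.elim (Function.update k e (K' + 1)) fun _ : Unit => 1)
          (Sum.elim (Function.update m e (m e)) fun _ : Unit => 1) := by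
        intro e'
        rcases e' with e' | ⟨⟩
        · simp only [Sum.elim_inl]
          exact hrep_other _ (K' + 1) (m e) hm0 hlt rfl e'
        · simp only [Sum.elim_inr]
          norm_num
      have key := ih (V ⊕ Unit) (E ⊕ Unit) (Expand.seriesEnds ends e x w) _ _ _ hrep' hsum''
        (Sum.inl o) (Sum.inl a₁) (Sum.inl a₂) (Sum.inl a₃) (Sum.inl b) (Sum.inl_injective.ne h12)
        (Sum.inl_injective.ne h13) (Sum.inl_injective.ne h23) (Sum.inl_injective.ne ho1)
        (Sum.inl_injective.ne ho2) (Sum.inl_injective.ne ho3) (Sum.inl_injective.ne hob)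
        (Sum.inl_injective.ne hb1) (Sum.inl_injective.ne hb2) (Sum.inl_injective.ne hb3)
      unfold HCov at key ⊢
      rw [Expand.Gc_series_expand p hf hxw hst o a₁ a₂ a₃ b]
      exact key
    · -- parallel: `p e = t + ½ − t · ½` with `t = (m e − 2^(k e − 1)) / 2^(k e − 1)`
      have hle : 2 ^ (K' + 1) ≤ m e := hgt.le
      have hst : p e = ((m e - 2 ^ (K' + 1) : ℕ) : R) / 2 ^ (K' + 1) + 1 / 2 -
          ((m e - 2 ^ (K' + 1) : ℕ) : R) / 2 ^ (K' + 1) * (1 / 2) := by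
        rw [hpe, Nat.cast_sub hle]
        push_cast
        field_simp
        ring
      have hrep' : IsDyadicRep
          (Sum.elim (Function.update p e (((m e - 2 ^ (K' + 1) : ℕ) : R) / 2 ^ (K' + 1)))
            fun _ : Unit => (1 / 2 : R))
          (Sum.elim (Function.update k e (K' + 1)) fun _ : Unit => 1)
          (Sum.elim (Function.update m e (m e - 2 ^ (K' + 1))) fun _ : Unit => 1) := by
        intro e'
        rcases e' with e' | ⟨⟩
        · simp only [Sum.elim_inl]
          exact hrep_other _ (K' + 1) (m e - 2 ^ (K' + 1)) (by omega)
            (by rw [h2pow] at hm1; omega) rfl e'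
        · simp only [Sum.elim_inr]
          norm_num
      have key := ih (V ⊕ Unit) (E ⊕ Unit) (Expand.parallelEnds ends e) _ _ _ hrep' hsum''
        (Sum.inl o) (Sum.inl a₁) (Sum.inl a₂) (Sum.inl a₃) (Sum.inl b) (Sum.inl_injective.ne h12)
        (Sum.inl_injective.ne h13) (Sum.inl_injective.ne h23) (Sum.inl_injective.ne ho1)
        (Sum.inl_injective.ne ho2) (Sum.inl_injective.ne ho3) (Sum.inl_injective.ne hob)
        (Sum.inl_injective.ne hb1) (Sum.inl_injective.ne hb2) (Sum.inl_injective.ne hb3)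
      unfold HCov at key ⊢
      rw [Expand.Gc_parallel_expand p e o hst o a₁ a₂ a₃ b]
      exact key

end Expansion

/-! ## Density of the dyadic points -/

section Density

/-- Between two reals there is a dyadic rational `m / 2^k`. -/
lemma exists_dyadic_btwn {a b : ℝ} (hab : a < b) :
    ∃ (m : ℤ) (k : ℕ), a < (m : ℝ) / 2 ^ k ∧ (m : ℝ) / 2 ^ k < b := by
  obtain ⟨k, hk⟩ := exists_pow_lt_of_lt_one (sub_pos.2 hab) (by norm_num : (1 / 2 : ℝ) < 1)
  have hpos : (0 : ℝ) < 2 ^ k := by positivity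
  refine ⟨⌊a * 2 ^ k⌋ + 1, k, ?_, ?_⟩
  · rw [lt_div_iff₀ hpos]
    push_cast
    exact Int.lt_floor_add_one _
  · rw [div_lt_iff₀ hpos]
    push_cast
    have h1 : (⌊a * 2 ^ k⌋ : ℝ) ≤ a * 2 ^ k := Int.floor_le _
    have h2 : (1 / 2 : ℝ) ^ k * 2 ^ k = 1 := by
      rw [one_div, inv_pow, inv_mul_cancel₀ hpos.ne']
    have h3 : (1 / 2 : ℝ) ^ k * 2 ^ k < (b - a) * 2 ^ k := mul_lt_mul_of_pos_right hk hpos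
    linarith

/-- The dyadic rationals are dense in `ℝ`. -/
lemma dense_dyadic : Dense {x : ℝ | ∃ (m : ℤ) (k : ℕ), x = (m : ℝ) / 2 ^ k} := by
  refine dense_of_exists_between ?_
  intro a b hab
  obtain ⟨m, k, h1, h2⟩ := exists_dyadic_btwn hab
  exact ⟨(m : ℝ) / 2 ^ k, ⟨m, k, rfl⟩, h1, h2⟩

/-- A dyadic point of `(0, 1)` has a representation with a natural numerator below `2^k`. -/
lemma rep_of_mem_Ioo {x : ℝ} (hx : x ∈ Set.Ioo (0 : ℝ) 1) {m : ℤ} {k : ℕ}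
    (hxm : x = (m : ℝ) / 2 ^ k) : ∃ n : ℕ, 0 < n ∧ n < 2 ^ k ∧ x = (n : ℝ) / 2 ^ k := by
  have hpos : (0 : ℝ) < 2 ^ k := by positivity
  have hm0 : (0 : ℝ) < m := by
    have := hx.1
    rw [hxm, div_pos_iff_of_pos_right hpos] at this
    exact this
  have hm0' : 0 < m := by exact_mod_cast hm0
  refine ⟨m.toNat, by omega, ?_, ?_⟩
  · have h1 : (m : ℝ) < 2 ^ k := by
      have := hx.2
      rwa [hxm, div_lt_one hpos] at this
    have h2 : ((m.toNat : ℤ) : ℝ) < 2 ^ k := by rwa [Int.toNat_of_nonneg hm0'.le]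
    exact_mod_cast h2
  · rw [hxm]
    congr 1
    rw [← Int.cast_natCast, Int.toNat_of_nonneg hm0'.le]

end Density

/-! ## The statement of record -/

section Main

/-- **(HCOV) at `p ≡ ½` on every multigraph gives the crux over `ℝ`**: the dyadic points of the
open cube are dense in the closed cube, `{p | 0 ≤ Gc p}` is closed, and every dyadic instance
expands to a multigraph at ½. -/
theorem HCov_all_of_half (h : HCov_half_all ℝ) : HCov_all ℝ := by
  intro V E _ _ _ _ ends p hp o a₁ a₂ a₃ b h12 h13 h23 ho1 ho2 ho3 hob hb1 hb2 hb3
  have hcl : IsClosed {q : E → ℝ | HCov q ends o a₁ a₂ a₃ b} := isClosed_HCov ends o a₁ a₂ a₃ b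
  set D : Set ℝ := {x : ℝ | ∃ (m : ℤ) (k : ℕ), x = (m : ℝ) / 2 ^ k}
  have hsub : Set.pi Set.univ (fun _ : E => Set.Ioo (0 : ℝ) 1 ∩ D) ⊆
      {q : E → ℝ | HCov q ends o a₁ a₂ a₃ b} := by
    intro q hq
    rw [Set.mem_univ_pi] at hq
    have hrep : ∀ e, ∃ n k : ℕ, 0 < n ∧ n < 2 ^ k ∧ q e = (n : ℝ) / 2 ^ k := fun e => by
      obtain ⟨m, k, hmk⟩ := (hq e).2
      obtain ⟨n, hn0, hn1, hn⟩ := rep_of_mem_Ioo (hq e).1 hmk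
      exact ⟨n, k, hn0, hn1, hn⟩
    choose n k hn using hrep
    exact HCov_of_half_dyadic h _ V E ends q k n (fun e => hn e) le_rfl o a₁ a₂ a₃ b h12 h13
      h23 ho1 ho2 ho3 hob hb1 hb2 hb3
  have hmem : p ∈ closure (Set.pi Set.univ (fun _ : E => Set.Ioo (0 : ℝ) 1 ∩ D)) := by
    rw [closure_pi_set, Set.mem_univ_pi]
    intro e
    have hdense : Set.Ioo (0 : ℝ) 1 ⊆ closure (Set.Ioo (0 : ℝ) 1 ∩ D) :=
      dense_dyadic.open_subset_closure_inter isOpen_Ioo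
    have hIcc : Set.Icc (0 : ℝ) 1 ⊆ closure (Set.Ioo (0 : ℝ) 1 ∩ D) := by
      rw [← closure_Ioo zero_ne_one]
      exact closure_minimal hdense isClosed_closure
    exact hIcc ⟨hp.nonneg e, hp.le_one e⟩
  exact hcl.closure_subset_iff.2 hsub hmem

/-- The crux gives its instance at `p ≡ ½`. -/
theorem half_of_HCov_all (R : Type*) [Field R] [LinearOrder R] [IsStrictOrderedRing R]
    (h : HCov_all R) : HCov_half_all R := by
  intro V E _ _ _ _ ends o a₁ a₂ a₃ b h12 h13 h23 ho1 ho2 ho3 hob hb1 hb2 hb3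
  exact h V E ends (fun _ => 1 / 2) ⟨fun _ => by norm_num, fun _ => by norm_num⟩ o a₁ a₂ a₃ b
    h12 h13 h23 ho1 ho2 ho3 hob hb1 hb2 hb3

/-- **THE UNIFORM-½ REDUCTION**: the crux over `ℝ` is (HCOV) at the uniform weight ½ on every
finite multigraph with five distinct marks. -/
theorem HCov_all_real_iff_half : HCov_all ℝ ↔ HCov_half_all ℝ :=
  ⟨half_of_HCov_all ℝ, HCov_all_of_half⟩

/-- The ½-statement over `ℚ` is the ½-statement over `ℝ` (`Gc` is a polynomial with integer
coefficients in the weights, `HCov_cast_iff`). -/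
theorem half_rat_iff_real : HCov_half_all ℚ ↔ HCov_half_all ℝ := by
  constructor
  · intro h V E _ _ _ _ ends o a₁ a₂ a₃ b h12 h13 h23 ho1 ho2 ho3 hob hb1 hb2 hb3
    have := (HCov_cast_iff (R := ℝ) (fun _ : E => (1 / 2 : ℚ)) ends o a₁ a₂ a₃ b).2
      (h V E ends o a₁ a₂ a₃ b h12 h13 h23 ho1 ho2 ho3 hob hb1 hb2 hb3)
    simpa using this
  · intro h V E _ _ _ _ ends o a₁ a₂ a₃ b h12 h13 h23 ho1 ho2 ho3 hob hb1 hb2 hb3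
    have := h V E ends o a₁ a₂ a₃ b h12 h13 h23 ho1 ho2 ho3 hob hb1 hb2 hb3
    rw [← HCov_cast_iff (R := ℝ) (fun _ : E => (1 / 2 : ℚ)) ends o a₁ a₂ a₃ b]
    simpa using this

/-- **THE CRUX IS A COUNTING STATEMENT**: `HCov_all ℝ ↔ HCov_half_all ℚ` — (HCOV) at `p ≡ ½` on
every finite multigraph, where every mass is a count of configurations over `2^|E|`
(`prob_half`). -/
theorem HCov_all_real_iff_half_rat : HCov_all ℝ ↔ HCov_half_all ℚ :=
  HCov_all_real_iff_half.trans half_rat_iff_real.symm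

end Main

end Half

end Summit.Ventures.PercRepro2
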